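import Summits.ResolutionOfSingularities.ResolutionOfSingularities.Theorems.UniversalCellsDefs

/-!
# Route UniversalCells — crux `Universality` (stmt-ResolutionOfSingularities-15234), line `birth`:
# stub `stub_flattening`

Flattening of a finite presentation into an ELEMENTARY one (Lee–Vakil 2012, §2, eq. (e:fg)):
for a prime `p` and a finite set `S ⊆ 𝔽_p[x_1, …, x_n]`, the algebra `𝔽_p[x] ⧸ ⟨S⟩` is
isomorphic to some `ElemRing p N Eadd Emul Eone = 𝔽_p[y_1, …, y_N] ⧸ ⟨E⟩` whose only relations
are `y_i + y_j = y_k`, `y_i · y_j = y_k` and `y_i = 1`.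

Proof (uniform, no syntax trees). Fix a finite down-closed box `G` of exponents containing `0`,
the coordinate vectors and the supports of the members of `S`. Take one generator `y_v` for every
coefficient vector `v : G → 𝔽_p` (a finite type), with intended value
`val v = ∑_{m ∈ G} v(m) x^m`, and let `Eadd`, `Emul`, `Eone` consist of ALL triples / indices
whose relation holds for the values in `𝔽_p[x] ⧸ ⟨S⟩`. The value map
`𝔽_p[y] ⧸ ⟨E⟩ → 𝔽_p[x] ⧸ ⟨S⟩` is then well defined; the map `x_k ↦ y_{[x_k]}` in the other
direction is well defined and inverse to it because, inside the elementary ring,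
`f(y_{[x_1]}, …, y_{[x_n]}) = y_{[f]}` for every `f` supported in `G` (induction over monomials,
constants `c = 1 + ⋯ + 1`, terms and sums, using only elementary relations), and `y_{[f]} = 0`
for `f ∈ S` by the elementary relation `y_{[f]} + y_{[f]} = y_{[f]}`.
-/

-- single-problem summit: the doubled namespace component `ResolutionOfSingularities` is forced
set_option linter.dupNamespace false

noncomputable section

open MvPolynomial

namespace Summit.ResolutionOfSingularities.ResolutionOfSingularities.Theorems.UniversalCells

namespace Flattening

variable {p : ℕ}

/-- An additive elementary relation holds in the elementary ring. [folklore] -/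
theorem gen_add {N : ℕ} {Eadd Emul : Finset (Fin N × Fin N × Fin N)} {Eone : Finset (Fin N)}
    {t : Fin N × Fin N × Fin N} (ht : t ∈ Eadd) :
    (Ideal.Quotient.mk (elemIdeal p N Eadd Emul Eone) (X t.1) : ElemRing p N Eadd Emul Eone) +
      Ideal.Quotient.mk _ (X t.2.1) = Ideal.Quotient.mk _ (X t.2.2) := by
  rw [← map_add, Ideal.Quotient.eq]
  exact Ideal.subset_span (Set.mem_union_left _ (Set.mem_union_left _ ⟨t, ht, rfl⟩))

/-- A multiplicative elementary relation holds in the elementary ring. [folklore] -/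
theorem gen_mul {N : ℕ} {Eadd Emul : Finset (Fin N × Fin N × Fin N)} {Eone : Finset (Fin N)}
    {t : Fin N × Fin N × Fin N} (ht : t ∈ Emul) :
    (Ideal.Quotient.mk (elemIdeal p N Eadd Emul Eone) (X t.1) : ElemRing p N Eadd Emul Eone) *
      Ideal.Quotient.mk _ (X t.2.1) = Ideal.Quotient.mk _ (X t.2.2) := by
  rw [← map_mul, Ideal.Quotient.eq]
  exact Ideal.subset_span (Set.mem_union_left _ (Set.mem_union_right _ ⟨t, ht, rfl⟩))

/-- A unit elementary relation holds in the elementary ring. [folklore] -/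
theorem gen_one {N : ℕ} {Eadd Emul : Finset (Fin N × Fin N × Fin N)} {Eone : Finset (Fin N)}
    {i : Fin N} (hi : i ∈ Eone) :
    (Ideal.Quotient.mk (elemIdeal p N Eadd Emul Eone) (X i) : ElemRing p N Eadd Emul Eone) = 1 := by
  rw [← (Ideal.Quotient.mk _).map_one, Ideal.Quotient.eq]
  exact Ideal.subset_span (Set.mem_union_right _ ⟨i, hi, rfl⟩)

/-- A finite down-closed box of exponent vectors containing `0`, the coordinate vectors and the
support of every member of `S`. [folklore] -/
theorem exists_box {n : ℕ} (S : Finset (MvPolynomial (Fin n) (ZMod p))) :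
    ∃ G : Finset (Fin n →₀ ℕ), (∀ a b : Fin n →₀ ℕ, a + b ∈ G → a ∈ G ∧ b ∈ G) ∧
      (0 : Fin n →₀ ℕ) ∈ G ∧ (∀ k : Fin n, Finsupp.single k 1 ∈ G) ∧
        ∀ f ∈ S, f.support ⊆ G := by
  classical
  refine ⟨Finset.Iic (∑ f ∈ S, ∑ m ∈ f.support, m + ∑ k : Fin n, Finsupp.single k 1),
    fun a b hab => ?_, Finset.mem_Iic.mpr zero_le, fun k => Finset.mem_Iic.mpr (le_add_left ?_),
    fun f hf m hm => Finset.mem_Iic.mpr (le_add_right ?_)⟩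
  · rw [Finset.mem_Iic] at hab
    exact ⟨Finset.mem_Iic.mpr (le_self_add.trans hab),
      Finset.mem_Iic.mpr (le_add_self.trans hab)⟩
  · exact Finset.single_le_sum (f := fun k : Fin n => Finsupp.single k 1) (fun _ _ => zero_le)
      (Finset.mem_univ k)
  · exact (Finset.single_le_sum (f := fun m : Fin n →₀ ℕ => m) (fun _ _ => zero_le) hm).trans
      (Finset.single_le_sum (f := fun f : MvPolynomial (Fin n) (ZMod p) => ∑ m ∈ f.support, m)
        (fun _ _ => zero_le) hf)

section Val

variable {σ R : Type*} [CommSemiring R]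

/-- The value `∑_{m ∈ G} v(m) x^m` of a coefficient vector is additive. [folklore] -/
theorem val_add {G : Finset (σ →₀ ℕ)} (u v : ↥G → R) :
    ∑ g : ↥G, monomial g.1 ((u + v) g) =
      ∑ g : ↥G, monomial g.1 (u g) + ∑ g : ↥G, monomial g.1 (v g) := by
  simp only [Pi.add_apply, map_add, Finset.sum_add_distrib]

/-- The value of a coefficient vector concentrated in one exponent is a term. [folklore] -/
theorem val_single [DecidableEq σ] {G : Finset (σ →₀ ℕ)} (a : ↥G) (c : R) :
    ∑ g : ↥G, monomial g.1 (Pi.single a c g) = monomial a.1 c := by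
  rw [Finset.sum_eq_single a (fun b _ hb => by rw [Pi.single_eq_of_ne hb, map_zero])
    (fun h => (h (Finset.mem_univ a)).elim), Pi.single_eq_same]

/-- A polynomial supported in the box is the value of its coefficient vector. [folklore] -/
theorem val_coeff {G : Finset (σ →₀ ℕ)} (f : MvPolynomial σ R) (hf : f.support ⊆ G) :
    ∑ g : ↥G, monomial g.1 (coeff g.1 f) = f := by
  rw [Finset.sum_coe_sort G (fun m => monomial m (coeff m f)),
    ← Finset.sum_subset hf (fun m _ hm => by rw [notMem_support_iff.mp hm, map_zero])]
  exact (as_sum f).symm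

end Val

/-- Constants of `ZMod p` are iterated sums of `1`: a map `κ : ZMod p → B` with `κ 0 = 0` and
`κ (c + 1) = κ c + 1` is the structure map. [folklore] -/
theorem const_eq [NeZero p] {B : Type*} [Ring B] [Algebra (ZMod p) B] (κ : ZMod p → B)
    (h0 : κ 0 = 0) (h1 : ∀ c, κ (c + 1) = κ c + 1) (c : ZMod p) :
    κ c = algebraMap (ZMod p) B c := by
  have key : ∀ j : ℕ, κ (j : ZMod p) = (j : B) := fun j => by
    induction j with
    | zero => rw [Nat.cast_zero, Nat.cast_zero, h0]
    | succ j ih => rw [Nat.cast_succ, Nat.cast_succ, h1, ih]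
  calc κ c = κ ((c.val : ℕ) : ZMod p) := by rw [ZMod.natCast_zmod_val]
    _ = algebraMap (ZMod p) B (c.val : ZMod p) := by rw [key, map_natCast]
    _ = algebraMap (ZMod p) B c := by rw [ZMod.natCast_zmod_val]

/-- **Core evaluation lemma.** If `Y : (G → 𝔽_p) → B` is additive, kills `0`, sends the unit
vector at the exponent `0` to `1` and is multiplicative on terms, and `y_k = Y [x_k]`, then
evaluating the value polynomial of `v` at `y` gives `Y v`. [folklore] -/
theorem core [NeZero p] {n : ℕ} {B : Type*} [CommRing B] [Algebra (ZMod p) B]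
    (G : Finset (Fin n →₀ ℕ)) (hG : ∀ a b : Fin n →₀ ℕ, a + b ∈ G → a ∈ G ∧ b ∈ G) (z : ↥G)
    (hz : z.1 = 0) (Y : (↥G → ZMod p) → B) (y : Fin n → B)
    (h0 : Y 0 = 0) (hadd : ∀ u v, Y (u + v) = Y u + Y v) (hone : Y (Pi.single z 1) = 1)
    (hmul : ∀ a b c : ↥G, a.1 + b.1 = c.1 → ∀ x x' : ZMod p,
      Y (Pi.single c (x * x')) = Y (Pi.single a x) * Y (Pi.single b x'))
    (hy : ∀ (k : Fin n) (g : ↥G), g.1 = Finsupp.single k 1 → y k = Y (Pi.single g 1))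
    (v : ↥G → ZMod p) : aeval y (∑ g : ↥G, monomial g.1 (v g)) = Y v := by
  -- pure monomials `x^m`, `m ∈ G`
  have hzero : ∀ hm : (0 : Fin n →₀ ℕ) ∈ G,
      aeval y (monomial (0 : Fin n →₀ ℕ) (1 : ZMod p)) = Y (Pi.single ⟨0, hm⟩ 1) := by
    intro hm
    rw [show (⟨0, hm⟩ : ↥G) = z from Subtype.ext hz.symm, hone, monomial_zero', C_1, map_one]
  have hstep : ∀ a b : Fin n →₀ ℕ,
      (∀ ha : a ∈ G, aeval y (monomial a (1 : ZMod p)) = Y (Pi.single ⟨a, ha⟩ 1)) →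
      (∀ hb : b ∈ G, aeval y (monomial b (1 : ZMod p)) = Y (Pi.single ⟨b, hb⟩ 1)) →
      ∀ hab : a + b ∈ G,
        aeval y (monomial (a + b) (1 : ZMod p)) = Y (Pi.single ⟨a + b, hab⟩ 1) := by
    intro a b iha ihb hab
    obtain ⟨ha, hb⟩ := hG a b hab
    have h := hmul ⟨a, ha⟩ ⟨b, hb⟩ ⟨a + b, hab⟩ rfl 1 1
    simp only [mul_one] at h
    rw [h, ← iha ha, ← ihb hb, ← map_mul, monomial_mul, mul_one]
  have h1 : ∀ (m : Fin n →₀ ℕ) (hm : m ∈ G),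
      aeval y (monomial m (1 : ZMod p)) = Y (Pi.single ⟨m, hm⟩ 1) := by
    intro m
    induction m using Finsupp.induction_linear with
    | zero => exact hzero
    | add a b iha ihb => exact hstep a b iha ihb
    | single k e =>
      induction e with
      | zero => rw [Finsupp.single_zero]; exact hzero
      | succ e ih =>
        rw [Finsupp.single_add]
        exact hstep _ _ ih fun hk => by
          rw [← hy k ⟨_, hk⟩ rfl, ← X_pow_eq_monomial, pow_one, aeval_X]
  have h1' : ∀ g : ↥G, aeval y (monomial g.1 (1 : ZMod p)) = Y (Pi.single g 1) :=
    fun g => h1 g.1 g.2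
  -- constants
  have h2 : ∀ c : ZMod p, Y (Pi.single z c) = algebraMap (ZMod p) B c :=
    const_eq (fun c => Y (Pi.single z c)) (by rw [Pi.single_zero, h0])
      (fun c => by rw [Pi.single_add, hadd, hone])
  -- terms
  have h3 : ∀ (g : ↥G) (c : ZMod p), aeval y (monomial g.1 c) = Y (Pi.single g c) := by
    intro g c
    rw [← mul_one c, ← C_mul_monomial, map_mul, aeval_C, h1' g, ← h2,
      hmul z g g (by rw [hz, zero_add]) c 1]
  -- sums
  induction v using Pi.single_induction with
  | zero => simp only [Pi.zero_apply, map_zero, Finset.sum_const_zero]; exact h0.symm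
  | add u v hu hv => rw [val_add, map_add, hu, hv, hadd]
  | single g c => rw [val_single, h3]

/-- **The isomorphism**, for abstractly given relation sets: if `w ∘ e` is the value map into
`𝔽_p[x] ⧸ ⟨S⟩` and `Eadd`, `Emul`, `Eone` are exactly the triples / indices whose relation
holds for `w`, then `𝔽_p[x] ⧸ ⟨S⟩ ≅ ElemRing p N Eadd Emul Eone`.
[cite: LeeVakil2012, §2, eq. (e:fg)] -/
theorem iso [NeZero p] {n N : ℕ} (S : Finset (MvPolynomial (Fin n) (ZMod p)))
    (G : Finset (Fin n →₀ ℕ)) (hG : ∀ a b : Fin n →₀ ℕ, a + b ∈ G → a ∈ G ∧ b ∈ G)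
    (h0G : (0 : Fin n →₀ ℕ) ∈ G) (hXG : ∀ k : Fin n, Finsupp.single k 1 ∈ G)
    (hSG : ∀ f ∈ S, f.support ⊆ G) (e : (↥G → ZMod p) ≃ Fin N)
    (w : Fin N →
      MvPolynomial (Fin n) (ZMod p) ⧸ Ideal.span (↑S : Set (MvPolynomial (Fin n) (ZMod p))))
    (hw : ∀ v, w (e v) = Ideal.Quotient.mk _ (∑ g : ↥G, monomial g.1 (v g)))
    (Eadd Emul : Finset (Fin N × Fin N × Fin N)) (Eone : Finset (Fin N))
    (hEadd : ∀ i j k, (i, j, k) ∈ Eadd ↔ w i + w j = w k)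
    (hEmul : ∀ i j k, (i, j, k) ∈ Emul ↔ w i * w j = w k)
    (hEone : ∀ i, i ∈ Eone ↔ w i = 1) :
    Nonempty ((MvPolynomial (Fin n) (ZMod p) ⧸
      Ideal.span (↑S : Set (MvPolynomial (Fin n) (ZMod p)))) ≃+*
        ElemRing p N Eadd Emul Eone) := by
  obtain ⟨Y, hY⟩ : ∃ Y : (↥G → ZMod p) → ElemRing p N Eadd Emul Eone,
      ∀ v, Y v = Ideal.Quotient.mk (elemIdeal p N Eadd Emul Eone) (X (e v)) :=
    ⟨_, fun _ => rfl⟩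
  obtain ⟨y, hy⟩ : ∃ y : Fin n → ElemRing p N Eadd Emul Eone,
      ∀ k, y k = Y (Pi.single ⟨Finsupp.single k 1, hXG k⟩ 1) := ⟨_, fun _ => rfl⟩
  -- the elementary relations, read in `ElemRing`
  have hadd : ∀ u v, Y (u + v) = Y u + Y v := fun u v => by
    rw [hY, hY, hY]
    refine (gen_add (t := (e u, e v, e (u + v))) ((hEadd _ _ _).mpr ?_)).symm
    rw [hw, hw, hw, val_add, map_add]
  have h0 : Y 0 = 0 := by
    have h := hadd 0 0
    rw [add_zero] at h
    exact add_eq_left.mp h.symm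
  have hone : Y (Pi.single ⟨0, h0G⟩ 1) = 1 := by
    rw [hY]
    refine gen_one ((hEone _).mpr ?_)
    rw [hw, val_single]
    simp only [← C_apply, map_one]
  have hmul : ∀ a b c : ↥G, a.1 + b.1 = c.1 → ∀ x x' : ZMod p,
      Y (Pi.single c (x * x')) = Y (Pi.single a x) * Y (Pi.single b x') := by
    intro a b c habc x x'
    rw [hY, hY, hY]
    refine (gen_mul (t := (e (Pi.single a x), e (Pi.single b x'), e (Pi.single c (x * x'))))
      ((hEmul _ _ _).mpr ?_)).symm
    rw [hw, hw, hw, val_single, val_single, val_single, ← map_mul, monomial_mul, habc]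
  have hy' : ∀ (k : Fin n) (g : ↥G), g.1 = Finsupp.single k 1 → y k = Y (Pi.single g 1) := by
    rintro k ⟨g, hg'⟩ hg
    simp only at hg
    subst hg
    exact hy k
  have hcore := core G hG ⟨0, h0G⟩ rfl Y y h0 hadd hone hmul hy'
  -- the members of `S` die in `ElemRing`
  have hS : ∀ f ∈ S, aeval y f = 0 := fun f hf => by
    have hv := hcore fun g => coeff g.1 f
    rw [val_coeff f (hSG f hf)] at hv
    have hrel :
        (e fun g => coeff g.1 f, e fun g => coeff g.1 f, e fun g => coeff g.1 f) ∈ Eadd := by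
      refine (hEadd _ _ _).mpr ?_
      rw [hw, val_coeff f (hSG f hf), Ideal.Quotient.eq_zero_iff_mem.mpr (Ideal.subset_span hf),
        add_zero]
    have h := gen_add (p := p) (Emul := Emul) (Eone := Eone) hrel
    rw [hv, hY]
    exact add_eq_left.mp h
  -- the two algebra maps
  have hΦker : ∀ a ∈ Ideal.span (↑S : Set (MvPolynomial (Fin n) (ZMod p))), aeval y a = 0 :=
    fun a ha => RingHom.mem_ker.mp ((Ideal.span_le (I := RingHom.ker (aeval y))).mpr
      (fun f hf => RingHom.mem_ker.mpr (hS f hf)) ha)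
  have hΨker : ∀ b ∈ elemIdeal p N Eadd Emul Eone, aeval w b = 0 := fun b hb => by
    refine RingHom.mem_ker.mp ((Ideal.span_le (I := RingHom.ker (aeval w))).mpr ?_ hb)
    rintro _ ((⟨t, ht, rfl⟩ | ⟨t, ht, rfl⟩) | ⟨i, hi, rfl⟩)
    · simpa [sub_eq_zero] using (hEadd t.1 t.2.1 t.2.2).mp ht
    · simpa [sub_eq_zero] using (hEmul t.1 t.2.1 t.2.2).mp ht
    · simpa [sub_eq_zero] using (hEone i).mp hi
  obtain ⟨Φ, hΦ⟩ : ∃ Φ : (MvPolynomial (Fin n) (ZMod p) ⧸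
      Ideal.span (↑S : Set (MvPolynomial (Fin n) (ZMod p)))) →ₐ[ZMod p]
        ElemRing p N Eadd Emul Eone, ∀ f, Φ (Ideal.Quotient.mk _ f) = aeval y f :=
    ⟨Ideal.Quotient.liftₐ _ (aeval y) hΦker, fun _ => rfl⟩
  obtain ⟨Ψ, hΨ⟩ : ∃ Ψ : ElemRing p N Eadd Emul Eone →ₐ[ZMod p]
      (MvPolynomial (Fin n) (ZMod p) ⧸ Ideal.span (↑S : Set (MvPolynomial (Fin n) (ZMod p)))),
        ∀ f, Ψ (Ideal.Quotient.mk _ f) = aeval w f :=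
    ⟨Ideal.Quotient.liftₐ _ (aeval w) hΨker, fun _ => rfl⟩
  refine ⟨(AlgEquiv.ofAlgHom Φ Ψ ?_ ?_).toRingEquiv⟩
  · refine Ideal.Quotient.algHom_ext _ (MvPolynomial.algHom_ext fun i => ?_)
    obtain ⟨v, rfl⟩ := e.surjective i
    simp only [AlgHom.coe_comp, Function.comp_apply, AlgHom.coe_id, id_eq,
      Ideal.Quotient.mkₐ_eq_mk]
    rw [hΨ, aeval_X, hw, hΦ, hcore, hY]
  · refine Ideal.Quotient.algHom_ext _ (MvPolynomial.algHom_ext fun k => ?_)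
    simp only [AlgHom.coe_comp, Function.comp_apply, AlgHom.coe_id, id_eq,
      Ideal.Quotient.mkₐ_eq_mk]
    rw [hΦ, aeval_X, hy, hY, hΨ, aeval_X, hw, val_single, ← X_pow_eq_monomial, pow_one]

end Flattening

/-- **Flattening of a finite presentation** (Lee–Vakil 2012, §2, eq. (e:fg)): every finitely
presented `𝔽_p`-algebra `𝔽_p[x_1, …, x_n] ⧸ ⟨S⟩` is isomorphic to an elementary ring
`𝔽_p[y_1, …, y_N] ⧸ ⟨y_i + y_j = y_k ((i,j,k) ∈ Eadd), y_i y_j = y_k ((i,j,k) ∈ Emul),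
y_i = 1 (i ∈ Eone)⟩`. [cite: LeeVakil2012, §2, eq. (e:fg)] -/
theorem stub_flattening (p : ℕ) (hp : p.Prime) (n : ℕ) (S : Finset (MvPolynomial (Fin n) (ZMod p))) : ∃ (N : ℕ) (Eadd Emul : Finset (Fin N × Fin N × Fin N)) (Eone : Finset (Fin N)), Nonempty ((MvPolynomial (Fin n) (ZMod p) ⧸ Ideal.span (↑S : Set (MvPolynomial (Fin n) (ZMod p)))) ≃+* ElemRing p N Eadd Emul Eone) := by
  classical
  haveI : NeZero p := ⟨hp.ne_zero⟩
  obtain ⟨G, hG, h0G, hXG, hSG⟩ := Flattening.exists_box (p := p) S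
  obtain ⟨e⟩ : Nonempty ((↥G → ZMod p) ≃ Fin (Fintype.card (↥G → ZMod p))) :=
    ⟨Fintype.equivFin _⟩
  obtain ⟨w, hw⟩ : ∃ w : Fin (Fintype.card (↥G → ZMod p)) →
      MvPolynomial (Fin n) (ZMod p) ⧸ Ideal.span (↑S : Set (MvPolynomial (Fin n) (ZMod p))),
      ∀ v, w (e v) = Ideal.Quotient.mk _ (∑ g : ↥G, monomial g.1 (v g)) :=
    ⟨fun i => Ideal.Quotient.mk _ (∑ g : ↥G, monomial g.1 (e.symm i g)), fun v => by
      simp only [Equiv.symm_apply_apply]⟩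
  exact ⟨_, Finset.univ.filter fun t => w t.1 + w t.2.1 = w t.2.2,
    Finset.univ.filter fun t => w t.1 * w t.2.1 = w t.2.2, Finset.univ.filter fun i => w i = 1,
    Flattening.iso S G hG h0G hXG hSG e w hw _ _ _ (by simp) (by simp) (by simp)⟩

end Summit.ResolutionOfSingularities.ResolutionOfSingularities.Theorems.UniversalCells

end
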